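import Summits.NavierStokesRegularity.NavierStokesRegularity.Theses.AxisymmetricExtremality
import Summits.NavierStokesRegularity.NavierStokesRegularity.Theorems.AxisymmetricExtremalityPFoldToAxisymmetricCompactModuloSim
import Summits.NavierStokesRegularity.NavierStokesRegularity.Theorems.AxisymmetricExtremalityPFoldToAxisymmetricAeAxisymmetricUpgrade
import Summits.NavierStokesRegularity.NavierStokesRegularity.Theorems.AxisymmetricExtremalityPFoldToAxisymmetricDenseAngleClosure

/-!
# Birth skeleton (`Lines/birth.lean`) for crux `PFoldToAxisymmetric`
# (item stmt-NavierStokesRegularity-15454, route `AxisymmetricExtremality`, rank 4)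

planner-skel-stmt-NavierStokesRegularity-15454-0, 2026-08-17 (skeleton-register, route re-audit bin
REPAIRABLE). No `Disproof.lean` exists for this crux (`ledger crux ls`: no workfiles) — Disproof used:
none relevant. Evidence honoured: the move37 seat's axis-pinning sketch attached to the item
(idea-mirror-kills-swirl.md, 2026-08-16: trichotomy on `θ_k · D_k`) is exactly `stub_axisPinning`.

THE CRUX. For `ν > 0`: if for unboundedly many `p ≥ 2` there are `p`-fold symmetric Rusin–Šverák
minimal blow-up data (equivariance under the rotation `R_{2π/p}` about the `x 2`-axis), then an
axisymmetric minimal blow-up datum exists (equivariance under every `R_θ`).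

THE LINE (the route's own two-layer plan "AxisPinning → ClosedSubgroupLimit", with the Rusin–Šverák
front end and the representative upgrade made explicit), four stubs:

* `stub_compactModuloSim` (L) — Rusin–Šverák Cor. 4.3 AT FULL STRENGTH, in `L³` form: a sequence of
  minimal blow-up data has, after modulation by scalings `λ_j > 0` and translations `x₀_j` and along a
  subsequence `φ`, an `L³`-limit which is AGAIN a minimal blow-up datum. In tree:
  `rusin_sverak_minimal_data_compact` (PROVED `_holds`) gives precompactness of the modulated
  `Ḣ^{1/2}` classes only; still to supply: `M` is closed (stability of global Kato solutions under
  `Ḣ^{1/2}`/`L³` perturbations, Gallagher–Iftimie–Planchon 2003 / Rusin–Šverák Thm. 4.2), `M` is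
  `Sim`-invariant (norm and no-global-solution invariance under scaling/translation), and
  `Ḣ^{1/2} ⊂ L³` for represented fields (`eLpNorm_three_le_eHomSobolevSeminorm_half`).
* `stub_axisPinning` (M/L, the load-bearing new lemma) — the modulated data are
  `(2π/p_j)`-equivariant about the VERTICAL axis through `a_j = x₀_j/λ_j`; with `θ_j = 2π/p_j → 0`
  and `D_j = dist(a_j, x 2-axis)`: (i) `θ_j D_j → ∞` contradicts strong `L³` convergence to the
  non-zero limit `u` (`u ∈ M ⇒ u ≠ 0` since `0` has the global Kato solution `0`; the rigid motion
  displaces the bulk of `u` to infinity yet `‖g_j·u − u‖₃ ≤ 2‖v_j − u‖₃ → 0`); (ii) `D_j → ∞` with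
  `θ_j D_j` bounded makes suitable powers `g_j^{m_j}` converge to a non-zero horizontal TRANSLATION
  leaving `u` invariant, and a periodic `L³` function is `0` — contradiction; (iii) hence `D_j` is
  bounded, `a_j → a` along a subsequence, and translating by the horizontal part of `a_j` (continuity
  of translations in `L³`, translation invariance of `M`) recentres every datum on the `x 2`-axis.
  Output: minimal data `V_j → u'` in `L³`, `u'` minimal, `V_j` `(2π/q_j)`-equivariant about the
  `x 2`-axis itself, `q_j → ∞`.
* `stub_denseAngleClosure` (M) — harmonic analysis only: a strong `L³` limit of fields equivariant
  under `R_{2π/q_j}`, `q_j → ∞`, is a.e.-equivariant under EVERY `R_θ` (the angles `2πk/q_j` are dense;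
  `θ ↦ u ∘ R_θ` is continuous into `L³` because rotations preserve Lebesgue measure and `C_c` is dense).
* `stub_aeAxisymmetricUpgrade` (M) — an a.e.-axisymmetric minimal blow-up datum has an EVERYWHERE
  axisymmetric representative which is again a minimal blow-up datum: `IsMinimalBlowupDatum ν · g` is
  invariant under a.e.-modification of the field (`MemLp`, `Represents`, `IsWeaklyDivFree` are
  integral conditions; a global Kato solution of the modified datum is re-anchored at `t = 0`), and
  the circle (Haar) average `x ↦ ⨍ R_{−θ} u (R_θ x) dθ` (set to `0` where not integrable) is exactly
  equivariant everywhere and equals `u` a.e. (Fubini).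

Composition `PFoldToAxisymmetric_of`: choose the symmetric data along `N ↦ p N ≥ N`; modulate and
pass to the limit (stub 1); pin and recentre the axes (stub 2, fed with `p ∘ φ → ∞`); close the dense
subgroup (stub 3); upgrade the representative (stub 4). Pure logic, kernel-checked, no sorry.

All stubs are stated over TREE VOCABULARY ONLY (rotations written out in coordinates exactly as in the
route file, `IsAxisymmetric`/`rotZ` unfolded), so each can be landed verbatim under
`Summits/NavierStokesRegularity/NavierStokesRegularity/Theorems/` with
`--supports stmt-NavierStokesRegularity-15454`.
Crux FQ name for the audit:
`Summit.NavierStokesRegularity.NavierStokesRegularity.Theses.AxisymmetricExtremality.PFoldToAxisymmetric`.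
-/

noncomputable section

namespace Summit.NavierStokesRegularity.NavierStokesRegularity.Cruxes.PFoldToAxisymmetric.Birth

open MeasureTheory Filter Topology
open scoped ENNReal

set_option linter.dupNamespace false

/-- **Stub 1 (Rusin–Šverák compactness modulo `Sim`, full strength, `L³` form).** For `ν > 0`, every
sequence of `Ḣ^{1/2}`-minimal blow-up data `(U k, G k)` admits scales `lam j > 0`, centres `x₀ j`, a
subsequence `φ` and a minimal blow-up datum `(u, g)` such that the modulated data
`x ↦ lam j • U (φ j) (lam j • x - x₀ j)` converge to `u` in `L³`.
(Rusin–Šverák 2011 Cor. 4.3 = `rusin_sverak_minimal_data_compact` + closedness and `Sim`-invariance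
of `M` + `Ḣ^{1/2} ⊂ L³`.) -/
theorem stub_compactModuloSim :
    ∀ ν : ℝ, 0 < ν →
    ∀ (U : ℕ → EuclideanSpace ℝ (Fin 3) → EuclideanSpace ℝ (Fin 3))
      (G : ℕ → Literature.Analysis.FunctionSpaces.HomSobolev (EuclideanSpace ℝ (Fin 3))
        (EuclideanSpace ℂ (Fin 3)) (1 / 2 : ℝ)),
      (∀ k, Literature.Analysis.FluidPDE.IsMinimalBlowupDatum ν (U k) (G k)) →
      ∃ (lam : ℕ → ℝ) (x₀ : ℕ → EuclideanSpace ℝ (Fin 3)) (φ : ℕ → ℕ)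
        (u : EuclideanSpace ℝ (Fin 3) → EuclideanSpace ℝ (Fin 3))
        (g : Literature.Analysis.FunctionSpaces.HomSobolev (EuclideanSpace ℝ (Fin 3))
          (EuclideanSpace ℂ (Fin 3)) (1 / 2 : ℝ)),
        (∀ j, 0 < lam j) ∧ StrictMono φ ∧
        Literature.Analysis.FluidPDE.IsMinimalBlowupDatum ν u g ∧
        Tendsto (fun j => eLpNorm
          (Literature.Analysis.FluidPDE.rescaleData (lam j) (fun x => U (φ j) (x - x₀ j)) - u)
          3 volume) atTop (𝓝 0) :=
  -- landed: p146603 (Theorems/AxisymmetricExtremalityPFoldToAxisymmetricCompactModuloSim.lean)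
  Summit.NavierStokesRegularity.NavierStokesRegularity.Theorems.PFoldToAxisymmetric.CompactModuloSim.stub_compactModuloSim

/-- **Stub 2 (axis pinning — the load-bearing lemma).** Let `(W j, G j)` be minimal blow-up data,
`W j` equivariant under the rotation by `2π/q j` about the `x 2`-axis, `q j → ∞`, and suppose the
modulated data `x ↦ lam j • W j (lam j • x - x₀ j)` (`lam j > 0`) converge in `L³` to a minimal
blow-up datum `u`. Then the symmetry axes (the vertical lines through `x₀ j / lam j`) stay at bounded
distance from the `x 2`-axis, so that after a horizontal recentring one obtains `L³` fields `V j`,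
equivariant under the rotation by `2π/q' j` about the `x 2`-axis itself with `q' j → ∞`, converging in
`L³` to a minimal blow-up datum `u'`. (Trichotomy on `θ_j D_j`; `u ∈ M ⇒ u ≠ 0`; periodic `L³` fields
vanish; continuity of translations in `L³`; translation invariance of `M`.) -/
theorem stub_axisPinning :
    ∀ ν : ℝ, 0 < ν →
    ∀ (W : ℕ → EuclideanSpace ℝ (Fin 3) → EuclideanSpace ℝ (Fin 3))
      (G : ℕ → Literature.Analysis.FunctionSpaces.HomSobolev (EuclideanSpace ℝ (Fin 3))
        (EuclideanSpace ℂ (Fin 3)) (1 / 2 : ℝ))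
      (q : ℕ → ℕ) (lam : ℕ → ℝ) (x₀ : ℕ → EuclideanSpace ℝ (Fin 3))
      (u : EuclideanSpace ℝ (Fin 3) → EuclideanSpace ℝ (Fin 3))
      (g : Literature.Analysis.FunctionSpaces.HomSobolev (EuclideanSpace ℝ (Fin 3))
        (EuclideanSpace ℂ (Fin 3)) (1 / 2 : ℝ)),
      (∀ j, Literature.Analysis.FluidPDE.IsMinimalBlowupDatum ν (W j) (G j)) →
      (∀ j (x : EuclideanSpace ℝ (Fin 3)),
        W j (WithLp.toLp 2 ![Real.cos (2 * Real.pi / q j) * x 0 - Real.sin (2 * Real.pi / q j) * x 1,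
          Real.sin (2 * Real.pi / q j) * x 0 + Real.cos (2 * Real.pi / q j) * x 1, x 2]) =
        WithLp.toLp 2 ![Real.cos (2 * Real.pi / q j) * W j x 0 - Real.sin (2 * Real.pi / q j) * W j x 1,
          Real.sin (2 * Real.pi / q j) * W j x 0 + Real.cos (2 * Real.pi / q j) * W j x 1, W j x 2]) →
      Tendsto q atTop atTop →
      (∀ j, 0 < lam j) →
      Literature.Analysis.FluidPDE.IsMinimalBlowupDatum ν u g →
      Tendsto (fun j => eLpNorm
        (Literature.Analysis.FluidPDE.rescaleData (lam j) (fun x => W j (x - x₀ j)) - u)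
        3 volume) atTop (𝓝 0) →
      ∃ (u' : EuclideanSpace ℝ (Fin 3) → EuclideanSpace ℝ (Fin 3))
        (g' : Literature.Analysis.FunctionSpaces.HomSobolev (EuclideanSpace ℝ (Fin 3))
          (EuclideanSpace ℂ (Fin 3)) (1 / 2 : ℝ)),
        Literature.Analysis.FluidPDE.IsMinimalBlowupDatum ν u' g' ∧
        ∃ (q' : ℕ → ℕ) (V : ℕ → EuclideanSpace ℝ (Fin 3) → EuclideanSpace ℝ (Fin 3)),
          Tendsto q' atTop atTop ∧ (∀ j, MemLp (V j) 3 volume) ∧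
          (∀ j (x : EuclideanSpace ℝ (Fin 3)),
            V j (WithLp.toLp 2 ![Real.cos (2 * Real.pi / q' j) * x 0 - Real.sin (2 * Real.pi / q' j) * x 1,
              Real.sin (2 * Real.pi / q' j) * x 0 + Real.cos (2 * Real.pi / q' j) * x 1, x 2]) =
            WithLp.toLp 2 ![Real.cos (2 * Real.pi / q' j) * V j x 0 - Real.sin (2 * Real.pi / q' j) * V j x 1,
              Real.sin (2 * Real.pi / q' j) * V j x 0 + Real.cos (2 * Real.pi / q' j) * V j x 1, V j x 2]) ∧
          Tendsto (fun j => eLpNorm (V j - u') 3 volume) atTop (𝓝 0) := by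
  sorry

/-- **Stub 3 (closure of the dense subgroup in `L³`).** A strong `L³` limit `u` of fields `V j`
equivariant under the rotation by `2π/q j` about the `x 2`-axis with `q j → ∞` is, for EVERY angle
`θ`, almost-everywhere equivariant under `R_θ` (the angles `2πk/q j` are dense in `ℝ`; the rotation
action on `L³(ℝ³)` is strongly continuous and isometric). Harmonic analysis only; no Navier–Stokes. -/
theorem stub_denseAngleClosure :
    ∀ (u : EuclideanSpace ℝ (Fin 3) → EuclideanSpace ℝ (Fin 3)) (q : ℕ → ℕ)
      (V : ℕ → EuclideanSpace ℝ (Fin 3) → EuclideanSpace ℝ (Fin 3)),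
      MemLp u 3 volume → (∀ j, MemLp (V j) 3 volume) → Tendsto q atTop atTop →
      (∀ j (x : EuclideanSpace ℝ (Fin 3)),
        V j (WithLp.toLp 2 ![Real.cos (2 * Real.pi / q j) * x 0 - Real.sin (2 * Real.pi / q j) * x 1,
          Real.sin (2 * Real.pi / q j) * x 0 + Real.cos (2 * Real.pi / q j) * x 1, x 2]) =
        WithLp.toLp 2 ![Real.cos (2 * Real.pi / q j) * V j x 0 - Real.sin (2 * Real.pi / q j) * V j x 1,
          Real.sin (2 * Real.pi / q j) * V j x 0 + Real.cos (2 * Real.pi / q j) * V j x 1, V j x 2]) →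
      Tendsto (fun j => eLpNorm (V j - u) 3 volume) atTop (𝓝 0) →
      ∀ θ : ℝ,
        (fun x : EuclideanSpace ℝ (Fin 3) =>
          u (WithLp.toLp 2 ![Real.cos θ * x 0 - Real.sin θ * x 1,
            Real.sin θ * x 0 + Real.cos θ * x 1, x 2])) =ᵐ[volume]
        fun x => WithLp.toLp 2 ![Real.cos θ * u x 0 - Real.sin θ * u x 1,
          Real.sin θ * u x 0 + Real.cos θ * u x 1, u x 2] :=
  -- landed: p148393 (Theorems/AxisymmetricExtremalityPFoldToAxisymmetricDenseAngleClosure.lean)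
  Summit.NavierStokesRegularity.NavierStokesRegularity.Theorems.PFoldToAxisymmetric.DenseAngleClosure.stub_denseAngleClosure

/-- **Stub 4 (representative upgrade).** A minimal blow-up datum which is almost-everywhere
equivariant under every rotation `R_θ` about the `x 2`-axis can be replaced by an EVERYWHERE
axisymmetric minimal blow-up datum: `IsMinimalBlowupDatum ν · g` is invariant under a.e.-modification
of the field, and the circle average `x ↦ ⨍ R_{−θ} u (R_θ x) dθ` (zero where not integrable) is an
exactly equivariant representative of the a.e.-class of `u`. -/
theorem stub_aeAxisymmetricUpgrade :
    ∀ (ν : ℝ) (u : EuclideanSpace ℝ (Fin 3) → EuclideanSpace ℝ (Fin 3))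
      (g : Literature.Analysis.FunctionSpaces.HomSobolev (EuclideanSpace ℝ (Fin 3))
        (EuclideanSpace ℂ (Fin 3)) (1 / 2 : ℝ)),
      Literature.Analysis.FluidPDE.IsMinimalBlowupDatum ν u g →
      (∀ θ : ℝ,
        (fun x : EuclideanSpace ℝ (Fin 3) =>
          u (WithLp.toLp 2 ![Real.cos θ * x 0 - Real.sin θ * x 1,
            Real.sin θ * x 0 + Real.cos θ * x 1, x 2])) =ᵐ[volume]
        fun x => WithLp.toLp 2 ![Real.cos θ * u x 0 - Real.sin θ * u x 1,
          Real.sin θ * u x 0 + Real.cos θ * u x 1, u x 2]) →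
      ∃ (u' : EuclideanSpace ℝ (Fin 3) → EuclideanSpace ℝ (Fin 3))
        (g' : Literature.Analysis.FunctionSpaces.HomSobolev (EuclideanSpace ℝ (Fin 3))
          (EuclideanSpace ℂ (Fin 3)) (1 / 2 : ℝ)),
        Literature.Analysis.FluidPDE.IsMinimalBlowupDatum ν u' g' ∧
        ∀ (θ : ℝ) (x : EuclideanSpace ℝ (Fin 3)),
          u' (WithLp.toLp 2 ![Real.cos θ * x 0 - Real.sin θ * x 1,
            Real.sin θ * x 0 + Real.cos θ * x 1, x 2]) =
          WithLp.toLp 2 ![Real.cos θ * u' x 0 - Real.sin θ * u' x 1,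
            Real.sin θ * u' x 0 + Real.cos θ * u' x 1, u' x 2] :=
  -- landed: p146797 (Theorems/AxisymmetricExtremalityPFoldToAxisymmetricAeAxisymmetricUpgrade.lean)
  Summit.NavierStokesRegularity.NavierStokesRegularity.Theorems.PFoldToAxisymmetric.AeAxisymmetricUpgrade.stub_aeAxisymmetricUpgrade

/-- **Composition (kernel-checked, no sorry of its own).** The four declared stubs imply the crux
`AxisymmetricExtremality.PFoldToAxisymmetric`, concluded BY NAME and using the stubs BY NAME (registered
skeleton convention, `#h21_check_skeleton`): choose the `p`-fold symmetric minimal data along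
`N ↦ p N ≥ N` (hypothesis of the crux), modulate and pass to a minimal `L³`-limit (stub 1), pin and
recentre the axes (stub 2, with `p ∘ φ → ∞`), close the dense subgroup of angles (stub 3), and upgrade
the a.e.-axisymmetric minimal datum to an everywhere axisymmetric one (stub 4). The same proof with the
four stub statements as explicit hypotheses (`bc/PFoldToAxisymmetric_birth_hypform.lean` in the seat
folder) depends only on `propext`, `Classical.choice`, `Quot.sound`. -/
theorem PFoldToAxisymmetric_of :
    Summit.NavierStokesRegularity.NavierStokesRegularity.Theses.AxisymmetricExtremality.PFoldToAxisymmetric := by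
  intro ν hν hfold
  -- the crux hypothesis: for every `N` a `p N`-fold symmetric minimal blow-up datum with `N ≤ p N`
  choose p hpN hp2 U G hmin hsym using hfold
  -- stub 1: modulate by `Sim` and pass to a minimal `L³`-limit along a subsequence `φ`
  obtain ⟨lam, x₀, φ, u, g, hlam, hφ, hminu, hconv⟩ := stub_compactModuloSim ν hν U G hmin
  -- the orders of symmetry still diverge along the subsequence
  have hq : Tendsto (fun j => p (φ j)) atTop atTop :=
    tendsto_atTop_mono (fun j => (hφ.id_le j).trans (hpN (φ j))) tendsto_id
  -- stub 2: pin the axes and recentre them on the `x 2`-axis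
  obtain ⟨u', g', hmin', q', V, hq', hV, hsymV, hconv'⟩ :=
    stub_axisPinning ν hν (fun j => U (φ j)) (fun j => G (φ j)) (fun j => p (φ j)) lam x₀ u g
      (fun j => hmin (φ j)) (fun j x => hsym (φ j) x) hq hlam hminu hconv
  -- stub 3: the limit is a.e.-equivariant under every rotation about the `x 2`-axis
  have hae := stub_denseAngleClosure u' q' V hmin'.1 hV hq' hsymV hconv'
  -- stub 4: upgrade to an everywhere axisymmetric minimal blow-up datum
  exact stub_aeAxisymmetricUpgrade ν u' g' hmin' hae

end Summit.NavierStokesRegularity.NavierStokesRegularity.Cruxes.PFoldToAxisymmetric.Birth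

end
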